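import Summits.AnomalousDissipation.AnomalousDissipation.Theses.SteadyWeakLimit
import Summits.AnomalousDissipation.AnomalousDissipation.Theorems.BaireTransferRobustLoudUpgradeStubSteadyWindow
import Literature.Analysis.FluidPDE.TorusClassicalLerayHopfProofs

/-!
# Route SteadyWeakLimit — the support `SteadyToSummit`

Proof of the route declaration
`Summit.AnomalousDissipation.AnomalousDissipation.Theses.SteadyWeakLimit.SteadyToSummit`
(item stmt-AnomalousDissipation-1311): the steady zeroth law (the antecedent is CoherentStates'
crux `SteadyZerothLaw`, item stmt-AnomalousDissipation-0219, verbatim) implies the summit statement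
`AnomalousDissipation = Literature.Turb.ZerothLaw`.

A steady classical state `u j` of `NS_{ν j}(f)` on `T³` is viewed as the time-independent
space–time field `fun _ => u j`, a classical solution on all of `ℝ × T³`, hence a global Leray–Hopf
solution from its own value at time `0`
(`Literature.Analysis.FunctionSpaces.Torus.IsClassicalNSSolutionOn.isGlobalLerayHopf`,
Robinson–Rodrigo–Sadowski 2016 Thm 6.5 / Galdi 2000 Thm 4.1, proved in
`Literature/Analysis/FluidPDE/TorusClassicalLerayHopfProofs.lean`). Its long-time budgets are the
instantaneous ones — the Cesàro mean of a constant is that constant (Doering–Foias 2002 §2), and the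
spectral gradient norm of a smooth slice is the pointwise one (Grafakos 2014 Prop. 3.2.6): these are
the landed lemmas `meanEnergy_const` (`⟨‖u‖₂²⟩ = ∫ ‖u j x‖²`) and `meanDissipation_const`
(`⟨ν‖∇u‖₂²⟩ = ν j * gradNormSq (u j)`) of
`Summits/AnomalousDissipation/AnomalousDissipation/Theorems/BaireTransferRobustLoudUpgradeStubSteadyWindow.lean`
(namespace `…Theorems.RobustLoudUpgrade.SteadyWindow`), reused rather than restated. With them the
clauses of `ZerothLaw` are those of the hypothesis, with the same `f`, `ν`, `E`, `ε`.

Design: no new definitions and no new lemmas. Not here: anything about the existence of such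
steady families (that is the crux 0219 / `SteadyWeakRealisation`).
-/

namespace Summit.AnomalousDissipation.AnomalousDissipation.Theorems

-- the mandated namespace `Summit.<Summit>.<Problem>.Theorems` repeats `AnomalousDissipation` (single-problem summit)
set_option linter.dupNamespace false

open Literature.Analysis.FunctionSpaces Literature.Analysis.FunctionSpaces.Torus
open Literature.Analysis.FluidPDE
open Summit.AnomalousDissipation.AnomalousDissipation.Theorems.RobustLoudUpgrade

/-- **The steady zeroth law implies the summit** (item stmt-AnomalousDissipation-1311, support of
route SteadyWeakLimit; the antecedent is CoherentStates' crux `SteadyZerothLaw`,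
stmt-AnomalousDissipation-0219, verbatim). Given a smooth divergence-free mean-zero steady force `f`,
viscosities `ν j → 0⁺`, steady classical Navier–Stokes states `(u j, p j)` forced by `f` with
`∫ ‖u j‖² ≤ E` and `ε ≤ ν j * gradNormSq (u j)` for some `ε > 0`, the time-independent fields
`fun _ => u j` are global Leray–Hopf solutions from `u j`
(`IsClassicalNSSolutionOn.isGlobalLerayHopf`) whose mean energy is `∫ ‖u j‖² ≤ E`
(`SteadyWindow.meanEnergy_const`) and whose mean dissipation is `ν j * gradNormSq (u j) ≥ ε`
(`SteadyWindow.meanDissipation_const`, slice smoothness from the classical solution), which is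
`Literature.Turb.ZerothLaw = AnomalousDissipation` with the same `f`, `ν`, `E`, `ε`. [folklore] -/
theorem steadyToSummit_proof :
    Summit.AnomalousDissipation.AnomalousDissipation.Theses.SteadyWeakLimit.SteadyToSummit := by
  unfold Summit.AnomalousDissipation.AnomalousDissipation.Theses.SteadyWeakLimit.SteadyToSummit
  rintro ⟨f, hf, hdiv, hmean, ν, u, p, hν, hν0, hsol, ⟨E, hE⟩, ε, hε, hεle⟩
  refine ⟨f, hf, hdiv, hmean, ν, fun j => u j, fun j _ => u j, hν, hν0,
    fun j => (hsol j).isGlobalLerayHopf, ⟨E, fun j => ?_⟩, ε, hε, fun j => ?_⟩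
  · rw [SteadyWindow.meanEnergy_const]
    exact hE j
  · rw [SteadyWindow.meanDissipation_const (ν j)
      ((hsol j).smooth_velocity.isSmooth_slice (Set.mem_univ (0 : ℝ)))]
    exact hεle j

end Summit.AnomalousDissipation.AnomalousDissipation.Theorems
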